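import Summits.CriticalPhenomena.PercolationContinuityZ3.Theorems.PercNearOneGluingNoHeavyLowerTailSahiGridPatternTwoPayerReduction
import HarnessLib

/-!
# `NoHeavyLowerTail` (crux stmt-CriticalPhenomena-4575), Sahi programme P1: **CAP PACKINGS — LP weak duality for diagonal certificates, and condition (N) of the
# two-payer OR star from ONE finite packing certificate, for EVERY certificate of the inner block (every dimension)**

Support file (Sahi cell, seat `prim-sahi-p1`, generation 39; `--supports stmt-CriticalPhenomena-4575`).  Pure proofs, no definitions, no `sorry`, standard axioms.
Continuation of `…SahiGridPatternTwoPayerReduction` (`twoPayer_slack_eq`, `twoPayer_N_of_dpart`, route D) and `…TwoPayerRoutesUA` (routes U/A).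

THE MATHEMATICS (seat memos FROM-prim-sahi-p1-gen38-FOUR-VALUED-SURPLUS §2.3–2.8 "CORE-Λ with (T_V)", "top-budget law"; gen39 memo).  A DIAGONAL CERTIFICATE of an up-set
`V ⊆ [3]^k` is `d ≥ 0` supported on `V` with (N_V) `Θ_V(A×A′) ≤ d(A∩A′)` (all up-sets `A, A′`) and (T_V) `d(W) ≤ λ_V(W)` (all up-sets `W`).  The set of certificates is a
polyhedron, and every linear lower bound `Σ_q w(q) d(q) ≥ c` valid on it has an LP-duality proof: a CAP PACKING — pairs `(A_i, A′_i)` with multiplicities `a_i ∈ ℕ` and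
caps `W_j` with multiplicities `b_j ∈ ℕ` such that, pointwise on `V`, `Σ_i a_i·1_{A_i∩A′_i} − Σ_j b_j·1_{W_j} ≤ w` — of value `Σ_i a_i Θ_V(A_i×A′_i) − Σ_j b_j λ_V(W_j) ≥ c`.
* **`cert_capPacking_le`** (every `k`; WEAK DUALITY): for every certificate `d` and every cap packing dominated by `w` on `V`,
  `Σ_i a_i Θ_V(A_i×A′_i) − Σ_j b_j λ_V(W_j) ≤ Σ_q w(q)·d(q)`.  (Two lines: (N_V) on each pair, (T_V) on each cap, then `d ≥ 0` pointwise on `V` and `d = 0` off `V`.)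
  The caps are what the generation-38 computation showed to be LOAD-BEARING from `k = 4` on: without caps a packing has total multiplicity at most `w(⊤)` at the top
  point (every footprint `A∩A′∩V` of positive value and every cap contains `⊤ = 2^k`), and at `k = 4` there are certified inner blocks for which no cap-free packing
  reaches the required value while a packing with caps does (census W144: 19 of 32 configurations; all 32 close with caps whose traces have ≤ 3 generators).
* **`twoPayer_N_of_capPacking`** (every `k`; the two-payer OR star `U = (x∧y) ∨ V ⊆ [3]^{2+k}` with its OR8 vector `e_d`, ARBITRARY test finsets `B, C`): let `e₀` be the
  OR8 vector built from the zero vector (it differs from `e_d` only on the four cells `a ∈ L = {01,02,10,20}`, where `e_d = (2·2^k + 2d)·1_V`).  If ONE cap packing dominated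
  by `w = 2·(1_{W_01} + 1_{W_02} + 1_{W_10} + 1_{W_20})` on `V` (`W_a = B_a ∩ C_a` the diagonal sections) has value `≥ Θ_U(B×C) − e₀(B∩C)`, then condition (N)
  `Θ_U(B×C) ≤ e_d(B∩C)` holds at `(B,C)` for EVERY certificate `d` of `V`.  Proof: `e_d(B∩C) = e₀(B∩C) + 2·Σ_{a∈L} d(W_a)` (two instances of `twoPayer_slack_eq`), and
  `2·Σ_{a∈L} d(W_a) ≥` the packing value by `cert_capPacking_le`.  This is the formal form of the generation-37/38 criterion "CORE-Λ with (T_V)": each exact LP dual of the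
  census (W142/W144) is such a packing, so each certified configuration is now ONE finite arithmetic check away from a Lean theorem valid for all certificates of its
  inner block; routes U, A, D of generations 36–38 are the cap-free packings with two pairs per cell.
Nothing here asserts `PatternPos d` for `d ≥ 4`, condition (N) for any particular configuration, or the existence of a packing in general (that existence, uniformly in
`k`, is exactly what remains open for the two-payer star). [this work]
-/

namespace Summit.CriticalPhenomena.PercolationContinuityZ3.Theorems.SahiGridPattern

open Finset SahiGrid3
open scoped BigOperators

variable {k : ℕ}

/-- **LP weak duality for diagonal certificates** (every `k`).  If `d ≥ 0` is supported on `V` and satisfies (N_V) and (T_V), and a cap packing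
`(a_i; A_i, A′_i)_i`, `(b_j; W_j)_j` of up-sets is dominated by the weight `w` pointwise on `V`
(`Σ_i a_i·1_{A_i∩A′_i}(q) − Σ_j b_j·1_{W_j}(q) ≤ w(q)` for `q ∈ V`), then `Σ_i a_i·Θ_V(A_i×A′_i) − Σ_j b_j·λ_V(W_j) ≤ Σ_q w(q)·d(q)`. [this work] -/
theorem cert_capPacking_le (V : Finset (Pd k)) (d : Pd k → ℤ) (hd0 : ∀ q, 0 ≤ d q) (hdV : ∀ q, q ∉ V → d q = 0)
    (hN : ∀ A A' : Finset (Pd k), IsUpperSet (A : Set (Pd k)) → IsUpperSet (A' : Set (Pd k)) →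
      (∑ q ∈ A, ∑ r ∈ A', thetaVal V q r) ≤ ∑ q ∈ A ∩ A', d q)
    (hT : ∀ W : Finset (Pd k), IsUpperSet (W : Set (Pd k)) → (∑ q ∈ W, d q) ≤ ∑ q ∈ W, lamU V q)
    {m m' : ℕ} (a : Fin m → ℕ) (A A' : Fin m → Finset (Pd k))
    (hA : ∀ i, IsUpperSet ((A i : Finset (Pd k)) : Set (Pd k))) (hA' : ∀ i, IsUpperSet ((A' i : Finset (Pd k)) : Set (Pd k)))
    (b : Fin m' → ℕ) (W : Fin m' → Finset (Pd k)) (hW : ∀ j, IsUpperSet ((W j : Finset (Pd k)) : Set (Pd k)))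
    (w : Pd k → ℤ)
    (hfeas : ∀ q ∈ V, (∑ i, (a i : ℤ) * ind (A i ∩ A' i) q) - (∑ j, (b j : ℤ) * ind (W j) q) ≤ w q) :
    (∑ i, (a i : ℤ) * ∑ q ∈ A i, ∑ r ∈ A' i, thetaVal V q r) - (∑ j, (b j : ℤ) * ∑ q ∈ W j, lamU V q) ≤ ∑ q, w q * d q := by
  classical
  -- (N_V) on every pair, (T_V) on every cap
  have h1 : (∑ i, (a i : ℤ) * ∑ q ∈ A i, ∑ r ∈ A' i, thetaVal V q r) ≤ ∑ i, (a i : ℤ) * ∑ q ∈ A i ∩ A' i, d q :=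
    Finset.sum_le_sum fun i _ => mul_le_mul_of_nonneg_left (hN (A i) (A' i) (hA i) (hA' i)) (by positivity)
  have h2 : (∑ j, (b j : ℤ) * ∑ q ∈ W j, d q) ≤ ∑ j, (b j : ℤ) * ∑ q ∈ W j, lamU V q :=
    Finset.sum_le_sum fun j _ => mul_le_mul_of_nonneg_left (hT (W j) (hW j)) (by positivity)
  -- both d-sums as pointwise sums against indicator combinations
  have e1 : (∑ i, (a i : ℤ) * ∑ q ∈ A i ∩ A' i, d q) = ∑ q, (∑ i, (a i : ℤ) * ind (A i ∩ A' i) q) * d q := by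
    have hh : ∀ i, (∑ q ∈ A i ∩ A' i, d q) = ∑ q, ind (A i ∩ A' i) q * d q := fun i => (sum_ind_mul_eq_sum_mem _ _).symm
    simp_rw [hh, Finset.mul_sum, Finset.sum_mul]
    rw [Finset.sum_comm]
    exact Finset.sum_congr rfl fun q _ => Finset.sum_congr rfl fun i _ => by ring
  have e2 : (∑ j, (b j : ℤ) * ∑ q ∈ W j, d q) = ∑ q, (∑ j, (b j : ℤ) * ind (W j) q) * d q := by
    have hh : ∀ j, (∑ q ∈ W j, d q) = ∑ q, ind (W j) q * d q := fun j => (sum_ind_mul_eq_sum_mem _ _).symm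
    simp_rw [hh, Finset.mul_sum, Finset.sum_mul]
    rw [Finset.sum_comm]
    exact Finset.sum_congr rfl fun q _ => Finset.sum_congr rfl fun j _ => by ring
  -- pointwise: on V by feasibility and d ≥ 0, off V because d = 0
  have h3 : (∑ q, (∑ i, (a i : ℤ) * ind (A i ∩ A' i) q) * d q) - (∑ q, (∑ j, (b j : ℤ) * ind (W j) q) * d q) ≤ ∑ q, w q * d q := by
    rw [← Finset.sum_sub_distrib]
    refine Finset.sum_le_sum fun q _ => ?_
    by_cases hq : q ∈ V
    · have hf := mul_le_mul_of_nonneg_right (hfeas q hq) (hd0 q)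
      rw [sub_mul] at hf
      exact hf
    · rw [hdV q hq]; simp
  linarith [h1, h2, e1, e2, h3]

/-- Bookkeeping: `Σ_q 2·(1_{W₁}+1_{W₂}+1_{W₃}+1_{W₄})(q)·d(q) = 2·(d(W₁)+d(W₂)+d(W₃)+d(W₄))`. [this work] -/
theorem sum_two_mul_four_ind_mul (W1 W2 W3 W4 : Finset (Pd k)) (d : Pd k → ℤ) :
    (∑ q, (2 * (ind W1 q + ind W2 q + ind W3 q + ind W4 q)) * d q)
      = 2 * ((∑ q ∈ W1, d q) + (∑ q ∈ W2, d q) + (∑ q ∈ W3, d q) + (∑ q ∈ W4, d q)) := by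
  rw [← sum_ind_mul_eq_sum_mem W1 d, ← sum_ind_mul_eq_sum_mem W2 d, ← sum_ind_mul_eq_sum_mem W3 d, ← sum_ind_mul_eq_sum_mem W4 d,
    ← Finset.sum_add_distrib, ← Finset.sum_add_distrib, ← Finset.sum_add_distrib, Finset.mul_sum]
  exact Finset.sum_congr rfl fun q _ => by ring

section TwoPayer

variable {V : Finset (Pd k)} {U B C : Finset (Pd (1 + (1 + k)))}

/-- **Condition (N) of the two-payer OR star from ONE cap packing, for every certificate of the inner block** (every `k`; `B, C` arbitrary finsets).
`e_d` is the OR8 vector of `U = (x∧y) ∨ V` built from `d`, `e₀` the one built from the zero vector; `W_a = B_a ∩ C_a` (`a ∈ {01,02,10,20}`) are the diagonal sections.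
If `d ≥ 0` is supported on `V` with (N_V), (T_V), and a cap packing of up-sets dominated on `V` by `2·(1_{W_01}+1_{W_02}+1_{W_10}+1_{W_20})` has value
`≥ Θ_U(B×C) − e₀(B∩C)`, then `Θ_U(B×C) ≤ e_d(B∩C)`. [this work] -/
theorem twoPayer_N_of_capPacking (hU : ∀ (ξ η : Pd 1) (q : Pd k), glue ξ (glue η q) ∈ U ↔ ((1 ≤ ξ 0 ∧ 1 ≤ η 0) ∨ q ∈ V))
    (d : Pd k → ℤ) (hd0 : ∀ q, 0 ≤ d q) (hdV : ∀ q, q ∉ V → d q = 0)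
    (hN : ∀ A A' : Finset (Pd k), IsUpperSet (A : Set (Pd k)) → IsUpperSet (A' : Set (Pd k)) →
      (∑ q ∈ A, ∑ r ∈ A', thetaVal V q r) ≤ ∑ q ∈ A ∩ A', d q)
    (hT : ∀ W : Finset (Pd k), IsUpperSet (W : Set (Pd k)) → (∑ q ∈ W, d q) ≤ ∑ q ∈ W, lamU V q)
    {m m' : ℕ} (a : Fin m → ℕ) (A A' : Fin m → Finset (Pd k))
    (hA : ∀ i, IsUpperSet ((A i : Finset (Pd k)) : Set (Pd k))) (hA' : ∀ i, IsUpperSet ((A' i : Finset (Pd k)) : Set (Pd k)))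
    (b : Fin m' → ℕ) (W : Fin m' → Finset (Pd k)) (hW : ∀ j, IsUpperSet ((W j : Finset (Pd k)) : Set (Pd k)))
    (hfeas : ∀ q ∈ V, (∑ i, (a i : ℤ) * ind (A i ∩ A' i) q) - (∑ j, (b j : ℤ) * ind (W j) q) ≤
      2 * ( ind ((sect (sect B (fun _ : Fin 1 => (0:Fin 3))) (fun _ : Fin 1 => (1:Fin 3))) ∩ (sect (sect C (fun _ : Fin 1 => (0:Fin 3))) (fun _ : Fin 1 => (1:Fin 3)))) q
          + ind ((sect (sect B (fun _ : Fin 1 => (0:Fin 3))) (fun _ : Fin 1 => (2:Fin 3))) ∩ (sect (sect C (fun _ : Fin 1 => (0:Fin 3))) (fun _ : Fin 1 => (2:Fin 3)))) q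
          + ind ((sect (sect B (fun _ : Fin 1 => (1:Fin 3))) (fun _ : Fin 1 => (0:Fin 3))) ∩ (sect (sect C (fun _ : Fin 1 => (1:Fin 3))) (fun _ : Fin 1 => (0:Fin 3)))) q
          + ind ((sect (sect B (fun _ : Fin 1 => (2:Fin 3))) (fun _ : Fin 1 => (0:Fin 3))) ∩ (sect (sect C (fun _ : Fin 1 => (2:Fin 3))) (fun _ : Fin 1 => (0:Fin 3)))) q ))
    (hval : (∑ x ∈ B, ∑ y ∈ C, thetaVal U x y) - (∑ x ∈ B ∩ C, (fun x : Pd (1 + (1 + k)) =>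
        if (1 ≤ freeOf x 0 ∧ 1 ≤ freeOf (cellOf x) 0) then (4 * 2 ^ k + 3 * (2 ^ k * ind V (cellOf (cellOf x)) - (nuCount V (cellOf (cellOf x)) : ℤ)))
        else if (freeOf x 0 = 0 ∧ freeOf (cellOf x) 0 = 0) then 4 * 2 ^ k * ind V (cellOf (cellOf x))
        else (2 * 2 ^ k) * ind V (cellOf (cellOf x))) x)
      ≤ (∑ i, (a i : ℤ) * ∑ q ∈ A i, ∑ r ∈ A' i, thetaVal V q r) - (∑ j, (b j : ℤ) * ∑ q ∈ W j, lamU V q)) :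
    (∑ x ∈ B, ∑ y ∈ C, thetaVal U x y) ≤ ∑ x ∈ B ∩ C, (fun x : Pd (1 + (1 + k)) =>
        if (1 ≤ freeOf x 0 ∧ 1 ≤ freeOf (cellOf x) 0) then (4 * 2 ^ k + 3 * (2 ^ k * ind V (cellOf (cellOf x)) - (nuCount V (cellOf (cellOf x)) : ℤ)))
        else if (freeOf x 0 = 0 ∧ freeOf (cellOf x) 0 = 0) then 4 * 2 ^ k * ind V (cellOf (cellOf x))
        else (2 * 2 ^ k + 2 * d (cellOf (cellOf x))) * ind V (cellOf (cellOf x))) x := by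
  classical
  -- the slack identity for `d` and for the zero vector: their difference is `2·Σ_{a∈L} d(W_a)`
  have hs := twoPayer_slack_eq (B := B) (C := C) hU d hdV
  have hs0 := twoPayer_slack_eq (B := B) (C := C) hU (fun _ => (0:ℤ)) (fun _ _ => rfl)
  -- weak duality with the weight `2·Σ_{a∈L} 1_{W_a}`
  have hwd := cert_capPacking_le V d hd0 hdV hN hT a A A' hA hA' b W hW _ hfeas
  rw [sum_two_mul_four_ind_mul] at hwd
  simp only [mul_zero, add_zero, Finset.sum_const_zero] at hs hs0 hval ⊢
  linarith [hs, hs0, hval, hwd]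

end TwoPayer

end Summit.CriticalPhenomena.PercolationContinuityZ3.Theorems.SahiGridPattern
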